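import Mathlib
import HarnessLib
import Literature.AlgebraicGeometry.Resolution.KiralyLutkebohmert

/-!
# S1a — (T2e, N1) INVARIANTS vs LOCALISATION for an automorphism of finite order

[OURS · L1 W4.5c · lead-1 g7; consumer chain of the one-shot kill, T2E-BRIEF (N1)(N2)] — NOT statements of the
manuscript; counted 0; AI-level work, weaker than expert review. Crux stmt-ResolutionOfSingularities-17941, line
`s1a-logminvertex` v6, stub `stub_winningStrategy` ((R0) branch).

For a ring automorphism `τ` of `C` and the ring of invariants `A = invariantSubring τ`:
* `exists_fixed_mk'_of_apply_eq` — **(N1)** if `T ≤ C` is a submonoid of `τ`-FIXED elements and `φ` is an endomorphism of a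
  localisation `C[T⁻¹]` extending `τ`, every `φ`-fixed element is `c / t` with `τ c = c`, `t ∈ T`;
* the cyclic group `Subgroup.zpowers τ` (inside `C ≃+* C`) acts on `C` with `Algebra.IsInvariant A C (zpowers τ)`
  (`isInvariant_zpowers`), so Mathlib's transitivity on primes applies (`exists_pow_map_eq_of_under_eq`);
* `finite_zpowers_of_iterate_eq` — `τ^[p] = id`, `0 < p` ⇒ the group is finite; `isIntegral_invariantSubring`;
* norms at a `τ`-stable prime: `iterate_mem_iff_of_stable`, `prod_iterate_mem_invariantSubring`, `dvd_prod_iterate`,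
  `prod_iterate_not_mem`;
* **(SAT)** `isLocalization_algebraMapSubmonoid_of_stable` — at a `τ`-STABLE prime `𝔓` over `𝔮 = 𝔓 ∩ A`, the local ring
  `C_𝔓` is already the localisation of `C` at (the image of) `A ∖ 𝔮`.
-/

set_option linter.dupNamespace false

noncomputable section

open Literature.AlgebraicGeometry.Resolution
open scoped Pointwise

namespace Summit.ResolutionOfSingularities.ResolutionOfSingularities.Theorems.WildQuotientResolution.S1.InvariantsRegular

universe u

variable {C : Type u} [CommRing C] (τ : C ≃+* C)

/-! ## (N1) fixed elements of a localisation at fixed denominators -/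

/-- **(N1)** Let `T` consist of `τ`-fixed elements, `C[T⁻¹]` a localisation and `φ` a ring endomorphism of `C[T⁻¹]` extending
`τ`. Every `φ`-fixed element is a fraction `c / t` with `τ c = c` and `t ∈ T`. [OURS · L1 W4.5c] -/
theorem exists_fixed_mk'_of_apply_eq (T : Submonoid C) (hT : ∀ t ∈ T, τ t = t) {Cₜ : Type*} [CommRing Cₜ]
    [Algebra C Cₜ] [IsLocalization T Cₜ] (φ : Cₜ →+* Cₜ) (hφ : ∀ c : C, φ (algebraMap C Cₜ c) = algebraMap C Cₜ (τ c))
    {x : Cₜ} (hx : φ x = x) : ∃ (c : C) (t : T), τ c = c ∧ x = IsLocalization.mk' Cₜ c t := by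
  obtain ⟨c₀, t₀, rfl⟩ := IsLocalization.exists_mk'_eq T x
  have h1 : IsLocalization.mk' Cₜ c₀ t₀ * algebraMap C Cₜ (t₀ : C) = algebraMap C Cₜ c₀ := IsLocalization.mk'_spec Cₜ c₀ t₀
  have h2 : algebraMap C Cₜ (τ c₀) = algebraMap C Cₜ c₀ := by
    have := congrArg φ h1
    rw [map_mul, hx, hφ, hφ, hT _ t₀.2] at this
    exact this.symm.trans h1
  obtain ⟨u, hu⟩ := IsLocalization.exists_of_eq (M := T) h2
  refine ⟨c₀ * u, t₀ * u, ?_, ?_⟩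
  · rw [map_mul, hT _ u.2, mul_comm (τ c₀), hu, mul_comm]
  · rw [IsLocalization.mk'_cancel]

/-! ## The cyclic group generated by `τ` -/

/-- `τ ^ n` acts as the `n`-th iterate. -/
theorem pow_apply (n : ℕ) (c : C) : (τ ^ n) c = τ^[n] c := by
  rw [RingAut.coe_pow]

/-- `τ^[p] = id` ⇒ `τ ^ p = 1` in `C ≃+* C`. -/
theorem pow_eq_one_of_iterate_eq {p : ℕ} (hτp : ∀ x : C, τ^[p] x = x) : τ ^ p = 1 := by
  ext x
  rw [pow_apply, hτp]
  rfl

/-- `τ^[p] = id` with `0 < p` ⇒ `τ` has finite order. -/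
theorem isOfFinOrder_of_iterate_eq {p : ℕ} (hp : 0 < p) (hτp : ∀ x : C, τ^[p] x = x) : IsOfFinOrder τ :=
  isOfFinOrder_iff_pow_eq_one.mpr ⟨p, hp, pow_eq_one_of_iterate_eq τ hτp⟩

/-- `τ^[p] = id` with `0 < p` ⇒ `zpowers τ` is finite. -/
theorem finite_zpowers_of_iterate_eq {p : ℕ} (hp : 0 < p) (hτp : ∀ x : C, τ^[p] x = x) :
    Finite (Subgroup.zpowers τ) :=
  (isOfFinOrder_of_iterate_eq τ hp hτp).finite_zpowers.to_subtype

/-- An element fixed by `τ` is fixed by every element of `zpowers τ`. -/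
theorem smul_eq_self_of_apply_eq {c : C} (hc : τ c = c) (g : Subgroup.zpowers τ) : g • c = c := by
  obtain ⟨g, k, rfl⟩ := g
  change (τ ^ k) c = c
  induction k using Int.induction_on with
  | zero => simp
  | succ n ih =>
    rw [zpow_add_one, RingAut.mul_apply, hc]
    exact ih
  | pred n ih =>
    have h' : τ⁻¹ c = c := by
      rw [RingAut.inv_apply]
      exact (τ.symm_apply_eq).mpr hc.symm
    rw [zpow_sub_one, RingAut.mul_apply, h']
    exact ih

/-- Fixed by `zpowers τ` ⟺ fixed by `τ`. -/
theorem forall_smul_eq_iff (c : C) : (∀ g : Subgroup.zpowers τ, g • c = c) ↔ τ c = c :=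
  ⟨fun h => h ⟨τ, Subgroup.mem_zpowers τ⟩, fun h g => smul_eq_self_of_apply_eq τ h g⟩

/-- The invariant subring is the fixed ring of `zpowers τ` (Mathlib's `Algebra.IsInvariant`). -/
theorem isInvariant_zpowers : Algebra.IsInvariant (invariantSubring τ) C (Subgroup.zpowers τ) :=
  ⟨fun c hc => ⟨⟨c, (forall_smul_eq_iff τ c).mp hc⟩, rfl⟩⟩

/-- The action of `zpowers τ` commutes with the `A`-scalars, `A` the ring of invariants. -/
theorem smulCommClass_zpowers : SMulCommClass (Subgroup.zpowers τ) (invariantSubring τ) C :=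
  ⟨fun g a c => by
    have ha : τ (algebraMap (invariantSubring τ) C a) = algebraMap (invariantSubring τ) C a := a.2
    rw [Algebra.smul_def, Algebra.smul_def, smul_mul', smul_eq_self_of_apply_eq τ ha g]⟩

/-- `C` is integral over the ring of invariants of an automorphism of finite order. -/
theorem isIntegral_invariantSubring {p : ℕ} (hp : 0 < p) (hτp : ∀ x : C, τ^[p] x = x) :
    Algebra.IsIntegral (invariantSubring τ) C := by
  haveI := finite_zpowers_of_iterate_eq τ hp hτp
  haveI := isInvariant_zpowers τ
  exact Algebra.IsInvariant.isIntegral (invariantSubring τ) C (Subgroup.zpowers τ)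

/-- The pointwise action of `g ∈ zpowers τ` on an ideal is `Ideal.map g`. -/
theorem zpowers_smul_ideal_eq_map (g : Subgroup.zpowers τ) (I : Ideal C) :
    g • I = I.map ((g : C ≃+* C) : C →+* C) := rfl

/-- Every element of `zpowers τ` is `τ ^ k` with `k < p` (when `τ^[p] = id`, `0 < p`). -/
theorem exists_pow_eq_of_mem_zpowers {p : ℕ} (hp : 0 < p) (hτp : ∀ x : C, τ^[p] x = x) (g : Subgroup.zpowers τ) :
    ∃ k : ℕ, k < p ∧ (g : C ≃+* C) = τ ^ k := by
  classical
  have hfin := isOfFinOrder_of_iterate_eq τ hp hτp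
  have hmem := (hfin.mem_zpowers_iff_mem_range_orderOf).mp g.2
  obtain ⟨k, hk, hk'⟩ := Finset.mem_image.mp hmem
  exact ⟨k, lt_of_lt_of_le (Finset.mem_range.mp hk) (orderOf_le_of_pow_eq_one hp (pow_eq_one_of_iterate_eq τ hτp)),
    hk'.symm⟩

/-- **Transitivity on the fibre** (Mathlib `Algebra.IsInvariant.exists_smul_of_under_eq` for `zpowers τ`): two primes of `C`
with the same contraction to the ring of invariants differ by a power of `τ`. -/
theorem exists_pow_map_eq_of_under_eq {p : ℕ} (hp : 0 < p) (hτp : ∀ x : C, τ^[p] x = x)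
    (P Q : Ideal C) [P.IsPrime] [Q.IsPrime]
    (hPQ : P.under (invariantSubring τ) = Q.under (invariantSubring τ)) :
    ∃ k : ℕ, k < p ∧ Q = P.map ((τ ^ k : C ≃+* C) : C →+* C) := by
  haveI := finite_zpowers_of_iterate_eq τ hp hτp
  haveI := isInvariant_zpowers τ
  haveI := smulCommClass_zpowers τ
  obtain ⟨g, hg⟩ := Algebra.IsInvariant.exists_smul_of_under_eq (invariantSubring τ) C (Subgroup.zpowers τ) P Q hPQ
  obtain ⟨k, hk, hgk⟩ := exists_pow_eq_of_mem_zpowers τ hp hτp g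
  refine ⟨k, hk, ?_⟩
  rw [hg, ← hgk]
  exact zpowers_smul_ideal_eq_map τ g P

/-! ## `τ`-stable primes and norms -/

/-- If `𝔓` is `τ`-stable then it is stable under all iterates. -/
theorem iterate_mem_iff_of_stable {𝔓 : Ideal C} (h𝔓 : ∀ x, x ∈ 𝔓 ↔ τ x ∈ 𝔓) (k : ℕ) (x : C) :
    τ^[k] x ∈ 𝔓 ↔ x ∈ 𝔓 := by
  induction k generalizing x with
  | zero => rfl
  | succ k ih => rw [Function.iterate_succ_apply, ih, ← h𝔓]

/-- The norm `∏_{k<p} τᵏ c` is `τ`-invariant (`τ^[p] = id`). -/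
theorem prod_iterate_mem_invariantSubring {p : ℕ} (hτp : ∀ x : C, τ^[p] x = x) (c : C) :
    (∏ k ∈ Finset.range p, τ^[k] c) ∈ invariantSubring τ := by
  rw [mem_invariantSubring_iff, map_prod]
  rcases Nat.eq_zero_or_pos p with rfl | hpos
  · simp
  · obtain ⟨p', rfl⟩ : ∃ p', p = p' + 1 := ⟨p - 1, by omega⟩
    have h1 : ∀ k, τ (τ^[k] c) = τ^[k + 1] c := fun k => by rw [Function.iterate_succ_apply']
    simp_rw [h1]
    rw [Finset.prod_range_succ, Finset.prod_range_succ' (fun k => τ^[k] c), hτp]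
    simp only [Function.iterate_zero, id_eq]

/-- `c` divides its norm (for `0 < p`). -/
theorem dvd_prod_iterate {p : ℕ} (hp : 0 < p) (c : C) : c ∣ ∏ k ∈ Finset.range p, τ^[k] c := by
  obtain ⟨p', rfl⟩ : ∃ p', p = p' + 1 := ⟨p - 1, by omega⟩
  rw [Finset.prod_range_succ']
  exact Dvd.intro_left _ rfl

/-- The norm of an element outside a `τ`-stable prime stays outside. -/
theorem prod_iterate_not_mem {𝔓 : Ideal C} [h : 𝔓.IsPrime] (h𝔓 : ∀ x, x ∈ 𝔓 ↔ τ x ∈ 𝔓) (p : ℕ) {c : C}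
    (hc : c ∉ 𝔓) : (∏ k ∈ Finset.range p, τ^[k] c) ∉ 𝔓 := by
  intro hmem
  obtain ⟨k, -, hk⟩ := h.prod_mem_iff.mp hmem
  exact hc ((iterate_mem_iff_of_stable τ h𝔓 k c).mp hk)

/-! ## (SAT) at a stable prime, `C_𝔓` is the localisation at `A ∖ 𝔮` -/

section Stable

variable (𝔓 : Ideal C) [𝔓.IsPrime] (𝔮 : Ideal (invariantSubring τ)) [𝔮.IsPrime] [𝔓.LiesOver 𝔮]

/-- The image of `A ∖ 𝔮` misses `𝔓` (`𝔓` over `𝔮`). -/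
theorem algebraMapSubmonoid_le_primeCompl :
    Algebra.algebraMapSubmonoid C 𝔮.primeCompl ≤ 𝔓.primeCompl := by
  rintro _ ⟨a, ha, rfl⟩ h
  apply ha
  change a ∈ 𝔮
  rw [Ideal.LiesOver.over (P := 𝔓) (p := 𝔮)]
  exact h

/-- **(SAT)** At a `τ`-stable prime `𝔓` lying over `𝔮`, the local ring `C_𝔓` is the localisation of `C` at the image of
`A ∖ 𝔮`: every `c ∉ 𝔓` divides its norm, which is an invariant outside `𝔮`. [OURS · L1 W4.5c] -/
theorem isLocalization_algebraMapSubmonoid_of_stable {p : ℕ} (hp : 0 < p) (hτp : ∀ x : C, τ^[p] x = x)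
    (h𝔓 : ∀ x, x ∈ 𝔓 ↔ τ x ∈ 𝔓) :
    IsLocalization (Algebra.algebraMapSubmonoid C 𝔮.primeCompl) (Localization.AtPrime 𝔓) := by
  -- the localisation at the small submonoid is already a localisation at `𝔓.primeCompl` (saturation) …
  haveI : IsLocalization 𝔓.primeCompl (Localization (Algebra.algebraMapSubmonoid C 𝔮.primeCompl)) := by
    refine IsLocalization.of_le_of_exists_dvd (Algebra.algebraMapSubmonoid C 𝔮.primeCompl) 𝔓.primeCompl
      (algebraMapSubmonoid_le_primeCompl τ 𝔓 𝔮) ?_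
    intro n hn
    refine ⟨∏ k ∈ Finset.range p, τ^[k] n, ⟨⟨_, prod_iterate_mem_invariantSubring τ hτp n⟩, ?_, rfl⟩,
      dvd_prod_iterate τ hp n⟩
    intro hq
    have hq' : (⟨_, prod_iterate_mem_invariantSubring τ hτp n⟩ : invariantSubring τ) ∈ 𝔮 := hq
    rw [Ideal.LiesOver.over (P := 𝔓) (p := 𝔮)] at hq'
    exact prod_iterate_not_mem τ h𝔓 p hn hq'
  -- … hence isomorphic to `C_𝔓`, and we transport
  exact IsLocalization.isLocalization_of_algEquiv (Algebra.algebraMapSubmonoid C 𝔮.primeCompl)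
    (IsLocalization.algEquiv 𝔓.primeCompl (Localization (Algebra.algebraMapSubmonoid C 𝔮.primeCompl))
      (Localization.AtPrime 𝔓))

end Stable

end Summit.ResolutionOfSingularities.ResolutionOfSingularities.Theorems.WildQuotientResolution.S1.InvariantsRegular

end
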